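import Literature.Topology.FourManifolds.MorseDiscLemma
import Literature.Topology.FourManifolds.RegularLevelSplitting
import Literature.Topology.FourManifolds.CorkDecomposition
import Literature.Topology.FourManifolds.CerfPropositionFour
import Literature.Topology.FourManifolds.MorseExtrema
import HarnessLib

/-!
# A closed manifold with a Morse function having exactly two critical points is a twisted
# sphere; in dimension two it is diffeomorphic to `S²` (Reeb, Milnor 1963 Thm. 4.1 and Remark)

Topic `Literature/Topology/FourManifolds` (fact seat
`provefact-Literature.Topology.FourManifolds.exists_commGroup_homotopySphereClass`, Kervaire–Milnor's
Theorem 1.1; this file serves its dimension-`2` leaf `nonemptyDiffeomorphSphere_two`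
(`SmoothPoincareLowDim.lean`, "`Θ₂ = 0`", Kervaire–Milnor 1963, p. 507), whose Morse-theoretic
proof ends with the step formalised here).  Everything in this file is **proved**; no
definitions, no named facts.

Milnor, *Morse theory* (1963), Thm. 4.1 (Reeb): *"If `M` is a compact manifold and `f` is a
differentiable function on `M` with only two critical points, both of which are non-degenerate,
then `M` is homeomorphic to a sphere"*, with the Remark following the proof (p. 25): the proof
shows that *"`M` is the union of two closed `n`-cells matched along their common boundary"* —
i.e. a twisted sphere `Dⁿ ∪_φ Dⁿ` (Kervaire–Milnor 1963, §1; the tree's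
`Literature.Topology.FourManifolds.IsTwistedSphere`, `TwistedSpheres.lean`), which in general
need not be diffeomorphic to `Sⁿ` (Milnor 1956).  Proof printed there: the two critical points
are the minimum `p` and the maximum `q`; for `f p < a < f q` the sublevel set `Mᵃ = f⁻¹[f p, a]`
is a closed `n`-cell by the Lemma of Morse and Thm. 3.1, and so is `f⁻¹[a, f q]`.

Here, for a closed smooth manifold `M` of dimension `k + 1 ≥ 2` (compact, Hausdorff, charts in
`ℝᵏ⁺¹`) and a Morse function `f` whose critical set has exactly two elements:

* `IsMorse.exists_min_max_of_ncard_criticalSet_eq_two` — the two critical points are the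
  minimum `p` (index `0`) and the maximum `q` (index `k + 1`), `f p < f q`
  (`MorseExtrema.lean`: extrema are critical, of index `0` resp. `dim M`);
* `IsMorse.nonempty_diffeomorph_closedBall_regularSublevel` and
  `IsMorse.nonempty_diffeomorph_closedBall_regularSuperlevel` — if the critical set is `{p, q}`
  (`p` of index `0`, `q` of index `k + 1`) and `f p < a < f q`, the regular sublevel set `Mᵃ = {f ≤ a}` and the
  regular superlevel set `M_a = {a ≤ f}` (`RegularLevelSplitting.lean`) are diffeomorphic to the
  closed ball `𝔻ᵏ⁺¹`: each carries the adapted Morse function of `RegularSublevel.morseData`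
  (for `M_a`, of the turned-about function `a - f`, `MorseTurnAbout.lean`) with a single critical
  point, of index `0`, so the disc lemma `IsMorseAdapted.nonempty_diffeomorph_closedBall`
  (`MorseDiscLemma.lean`: Lemma of Morse + regular interval theorem) applies;
* **`IsMorse.exists_isTwistedSphere_of_ncard_criticalSet_eq_two`** — hence `M`, which is the
  gluing `Mᵃ ∪_{f⁻¹(a)} M_a` (`RegularSublevel.isBoundaryGluing_split`), is the gluing of two
  closed balls along a diffeomorphism `φ` of `𝕊ᵏ` (transport of the gluing along the two
  diffeomorphisms, `IsBoundaryGluing.transfer`, `CorkDecomposition.lean`): `IsTwistedSphere k φ M`;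
* **`IsMorse.nonempty_diffeomorph_sphere_two_of_ncard_criticalSet_eq_two`** — in dimension `2`
  every twisted sphere is diffeomorphic to `S²` (`TwistedSphere.nonempty_diffeomorph_sphere_two`,
  `CerfPropositionFour.lean`: every diffeomorphism of `S¹` extends over `D²`), so **a closed
  smooth surface with a Morse function having exactly two critical points is diffeomorphic to
  `S²`**; whence the dimension-`2` instance of the tree's Reeb fact
  `nonempty_homeomorph_sphere_of_ncard_criticalSet_eq_two` (`Morse.lean`),
  `nonempty_homeomorph_sphere_of_ncard_criticalSet_eq_two_two`.

The manifold `M` is taken in `Type`: the gluing transport of `CorkDecomposition.lean` requires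
the two pieces (`𝔻ᵏ⁺¹ : Type` and the sublevel set of `M`) to live in one universe, as do the
bundled twisted spheres of `TwistedSpheres.lean`.

## References

* J. Milnor, *Morse theory*, Ann. of Math. Studies 51 (1963), Thm. 4.1 and the Remark following
  its proof (p. 25); Lemma 2.2; Thm. 3.1. [Milnor1963]
* G. Reeb, *Sur certaines propriétés topologiques des variétés feuilletées*, Actualités Sci.
  Indust. 1183, Hermann (1952). [Reeb1952]
* M. Kervaire, J. Milnor, *Groups of homotopy spheres I*, Ann. of Math. 77 (1963), §1 (twisted
  spheres), §2 p. 507 (`Θ₂ = 0`). [KervaireMilnorAnnals1963]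
-/

noncomputable section

open scoped Manifold ContDiff Topology
open Set Function Metric Module Filter

namespace Literature.Topology.FourManifolds

/-! ### The two critical points are the minimum and the maximum -/

section MinMax

variable {k : ℕ} {M : Type*} [TopologicalSpace M] [CompactSpace M]
  [ChartedSpace (EuclideanSpace ℝ (Fin (k + 1))) M] [IsManifold (𝓡 (k + 1)) ∞ M] {f : M → ℝ}

/-- **A Morse function with exactly two critical points: they are the minimum and the maximum.**
On a closed manifold of dimension `k + 1 ≥ 1`, if the critical set of the Morse function `f` has
exactly two elements, then these are a point `p` of index `0` where `f` attains its minimum and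
a point `q` of index `k + 1` where `f` attains its maximum, and `f p < f q` (Milnor 1963, proof
of Thm. 4.1: "the two critical points must be the minimum and maximum points"; indices by
`MorseExtrema.lean`). [cite: Milnor1963, proof of Thm. 4.1] -/
theorem IsMorse.exists_min_max_of_ncard_criticalSet_eq_two (hf : IsMorse (𝓡 (k + 1)) f)
    (h2 : (criticalSet (𝓡 (k + 1)) f).ncard = 2) :
    ∃ p q : M, p ≠ q ∧ criticalSet (𝓡 (k + 1)) f = {p, q} ∧
      morseIndex (𝓡 (k + 1)) f p = 0 ∧ morseIndex (𝓡 (k + 1)) f q = k + 1 ∧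
      (∀ x, f p ≤ f x) ∧ (∀ x, f x ≤ f q) ∧ f p < f q := by
  obtain ⟨x₀, -⟩ := Set.nonempty_of_ncard_ne_zero (s := criticalSet (𝓡 (k + 1)) f) (by omega)
  haveI : Nonempty M := ⟨x₀⟩
  have hfin : (criticalSet (𝓡 (k + 1)) f).Finite := IsMorse.finite_criticalSet_holds hf
  obtain ⟨h0, hn⟩ := hf.one_le_ncard_criticalSetOfIndex_zero_and_self
  obtain ⟨p, hp, hp0⟩ :=
    Set.nonempty_of_ncard_ne_zero (s := criticalSetOfIndex (𝓡 (k + 1)) f 0) (by omega)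
  obtain ⟨q, hq, hqn⟩ :=
    Set.nonempty_of_ncard_ne_zero (s := criticalSetOfIndex (𝓡 (k + 1)) f (k + 1)) (by omega)
  have hpq : p ≠ q := by
    rintro rfl
    rw [hp0] at hqn
    exact absurd hqn (by omega)
  have hsub : ({p, q} : Set M) ⊆ criticalSet (𝓡 (k + 1)) f := by
    rintro x (rfl | rfl)
    · exact hp
    · exact hq
  have hcrit : criticalSet (𝓡 (k + 1)) f = {p, q} :=
    (Set.eq_of_subset_of_ncard_le hsub (by rw [h2, Set.ncard_pair hpq]) hfin).symm
  -- the minimum point is a critical point of index `0`, hence `p`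
  obtain ⟨x, -, hx⟩ :=
    isCompact_univ.exists_isMinOn univ_nonempty hf.contMDiff.continuous.continuousOn
  have hxmin : IsLocalMin f x := hx.isLocalMin univ_mem
  have hxc : IsMCriticalPt (𝓡 (k + 1)) f x := IsLocalMin.isMCriticalPt hxmin
  have hx0 : morseIndex (𝓡 (k + 1)) f x = 0 := hf.morseIndex_eq_zero_of_isLocalMin hxmin
  have hxp : x = p := by
    have hx' : x ∈ criticalSet (𝓡 (k + 1)) f := hxc
    rw [hcrit] at hx'
    rcases hx' with rfl | rfl
    · rfl
    · rw [hx0] at hqn; exact absurd hqn (by omega)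
  -- the maximum point is a critical point of index `k + 1`, hence `q`
  obtain ⟨y, -, hy⟩ :=
    isCompact_univ.exists_isMaxOn univ_nonempty hf.contMDiff.continuous.continuousOn
  have hymax : IsLocalMax f y := hy.isLocalMax univ_mem
  have hyc : IsMCriticalPt (𝓡 (k + 1)) f y := IsLocalMax.isMCriticalPt hymax
  have hyn : morseIndex (𝓡 (k + 1)) f y = k + 1 := by
    rw [hf.morseIndex_eq_finrank_of_isLocalMax hymax, finrank_euclideanSpace_fin]
  have hyq : y = q := by
    have hy' : y ∈ criticalSet (𝓡 (k + 1)) f := hyc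
    rw [hcrit] at hy'
    rcases hy' with rfl | rfl
    · rw [hp0] at hyn; exact absurd hyn (by omega)
    · rfl
  subst hxp hyq
  have hmin : ∀ z, f x ≤ f z := fun z => hx (mem_univ z)
  have hmax : ∀ z, f z ≤ f y := fun z => hy (mem_univ z)
  refine ⟨x, y, hpq, hcrit, hp0, hqn, hmin, hmax, ?_⟩
  -- if `f x = f y` the function is constant and `y` is a minimum, of index `0 ≠ k + 1`
  rcases (hmin y).lt_or_eq with hlt | heq
  · exact hlt
  · exfalso
    have hymin : IsLocalMin f y :=
      Filter.Eventually.of_forall fun z => by rw [← heq]; exact hmin z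
    have := hf.morseIndex_eq_zero_of_isLocalMin hymin
    rw [this] at hqn
    exact absurd hqn (by omega)

end MinMax

/-! ### The two halves are discs -/

section Discs

variable {k : ℕ} {M : Type*} [TopologicalSpace M] [T2Space M] [CompactSpace M]
  [ChartedSpace (EuclideanSpace ℝ (Fin (k + 1))) M] [IsManifold (𝓡 (k + 1)) ∞ M] {f : M → ℝ}
  {p q : M} {a : ℝ}

omit [T2Space M] [CompactSpace M] [IsManifold (𝓡 (k + 1)) ∞ M] in
/-- A level strictly between the values at the only two critical points is a regular level.
[cite: Milnor1963, proof of Thm. 4.1] -/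
theorem IsMorse.isRegularLevel_of_criticalSet_eq_pair (hf : IsMorse (𝓡 (k + 1)) f)
    (hcrit : criticalSet (𝓡 (k + 1)) f = {p, q}) (hpa : f p < a) (haq : a < f q) :
    IsRegularLevel (𝓡 (k + 1)) f a := by
  refine hf.isRegularLevel fun z hz => ?_
  have hz' : z ∈ criticalSet (𝓡 (k + 1)) f := hz
  rw [hcrit] at hz'
  rcases hz' with rfl | rfl
  · exact hpa.ne
  · exact haq.ne'

/-- **The lower half is a disc.**  If the critical set of the Morse function `f` on the closed
manifold `M` (dimension `k + 1 ≥ 2`) is `{p, q}` with `p` of index `0`, and `f p < a < f q`,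
then the regular sublevel set `Mᵃ = {f ≤ a}` is diffeomorphic to the closed ball `𝔻ᵏ⁺¹`: the
adapted Morse function `f|Mᵃ + (1 - a)` (`RegularSublevel.morseData`) has the single critical
point `p`, of index `0`, and the disc lemma (`IsMorseAdapted.nonempty_diffeomorph_closedBall`:
Lemma of Morse and Thm. 3.1) applies.  Milnor 1963, proof of Thm. 4.1: "`Mᵃ = f⁻¹[0, a]` is a
closed `n`-cell". [cite: Milnor1963, proof of Thm. 4.1 (p. 25)] -/
theorem IsMorse.nonempty_diffeomorph_closedBall_regularSublevel (hk : 1 ≤ k)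
    (hf : IsMorse (𝓡 (k + 1)) f) (hcrit : criticalSet (𝓡 (k + 1)) f = {p, q})
    (hp0 : morseIndex (𝓡 (k + 1)) f p = 0) (hpa : f p < a) (haq : a < f q)
    (h : IsRegularLevel (𝓡 (k + 1)) f a) :
    Nonempty (RegularSublevel h ≃ₘ⟮𝓡∂ (k + 1), 𝓡∂ (k + 1)⟯
      (Metric.closedBall (0 : EuclideanSpace ℝ (Fin (k + 1))) 1)) := by
  obtain ⟨hFa, hFcrit, hFind⟩ := RegularSublevel.morseData hf h
  have hpc : IsMCriticalPt (𝓡 (k + 1)) f p := by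
    have : p ∈ criticalSet (𝓡 (k + 1)) f := by rw [hcrit]; exact mem_insert _ _
    exact this
  set P : RegularSublevel h := RegularSublevel.mk h p hpa.le with hP
  have hPc : IsMCriticalPt (𝓡∂ (k + 1))
      (fun x : RegularSublevel h => f (RegularSublevel.incl h x) + (1 - a)) P :=
    (hFcrit P).2 hpc
  have huniq : ∀ x : RegularSublevel h, IsMCriticalPt (𝓡∂ (k + 1))
      (fun x : RegularSublevel h => f (RegularSublevel.incl h x) + (1 - a)) x → x = P := by
    intro x hx
    have hxc : RegularSublevel.incl h x ∈ criticalSet (𝓡 (k + 1)) f := (hFcrit x).1 hx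
    rw [hcrit] at hxc
    rcases hxc with hxp | hxq
    · exact RegularSublevel.injective_incl h (by rw [hxp, hP, RegularSublevel.incl_mk])
    · exact absurd (RegularSublevel.apply_incl_le h x) (by rw [hxq]; exact not_le.2 haq)
  have h0 : morseIndex (𝓡∂ (k + 1))
      (fun x : RegularSublevel h => f (RegularSublevel.incl h x) + (1 - a)) P = 0 :=
    (hFind P hpc).trans hp0
  exact hFa.nonempty_diffeomorph_closedBall hk hPc huniq h0

/-- **The upper half is a disc.**  Under the same hypotheses, with `q` of index `k + 1`, the
regular superlevel set `M_a = {a ≤ f}` — the regular sublevel set `{a - f ≤ 0}` of the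
turned-about Morse function `a - f` (`RegularSuperlevel`, `MorseTurnAbout.lean`) — is
diffeomorphic to `𝔻ᵏ⁺¹`: its adapted Morse function has the single critical point `q`, whose
index for `a - f` is `(k + 1) - (k + 1) = 0`.  Milnor 1963, proof of Thm. 4.1 (the cell
`f⁻¹[a, 1]`). [cite: Milnor1963, proof of Thm. 4.1 (p. 25)] -/
theorem IsMorse.nonempty_diffeomorph_closedBall_regularSuperlevel (hk : 1 ≤ k)
    (hf : IsMorse (𝓡 (k + 1)) f) (hcrit : criticalSet (𝓡 (k + 1)) f = {p, q})
    (hqn : morseIndex (𝓡 (k + 1)) f q = k + 1) (hpa : f p < a) (haq : a < f q)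
    (h : IsRegularLevel (𝓡 (k + 1)) f a) :
    Nonempty (RegularSuperlevel h ≃ₘ⟮𝓡∂ (k + 1), 𝓡∂ (k + 1)⟯
      (Metric.closedBall (0 : EuclideanSpace ℝ (Fin (k + 1))) 1)) := by
  have hg : IsMorse (𝓡 (k + 1)) (fun y => a - f y) := hf.const_sub a
  obtain ⟨hGa, hGcrit, hGind⟩ := RegularSublevel.morseData hg h.const_sub
  have hqc : IsMCriticalPt (𝓡 (k + 1)) f q := by
    have : q ∈ criticalSet (𝓡 (k + 1)) f := by
      rw [hcrit]; exact mem_insert_of_mem _ (mem_singleton _)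
    exact this
  have hdiff : ∀ z, MDifferentiableAt (𝓡 (k + 1)) 𝓘(ℝ, ℝ) f z := fun z =>
    hf.contMDiff.mdifferentiableAt (by simp)
  have hqcg : IsMCriticalPt (𝓡 (k + 1)) (fun y => a - f y) q :=
    (isMCriticalPt_const_sub_iff a (hdiff q)).2 hqc
  have hq_le : (fun y => a - f y) q ≤ 0 := by
    show a - f q ≤ 0
    linarith
  set Q : RegularSuperlevel h := RegularSublevel.mk h.const_sub q hq_le with hQ
  have hQc : IsMCriticalPt (𝓡∂ (k + 1))
      (fun x : RegularSuperlevel h =>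
        (fun y => a - f y) (RegularSublevel.incl h.const_sub x) + (1 - 0)) Q :=
    (hGcrit Q).2 hqcg
  have huniq : ∀ x : RegularSuperlevel h, IsMCriticalPt (𝓡∂ (k + 1))
      (fun x : RegularSuperlevel h =>
        (fun y => a - f y) (RegularSublevel.incl h.const_sub x) + (1 - 0)) x → x = Q := by
    intro x hx
    have hxc : RegularSublevel.incl h.const_sub x ∈ criticalSet (𝓡 (k + 1)) f :=
      (isMCriticalPt_const_sub_iff a (hdiff _)).1 ((hGcrit x).1 hx)
    rw [hcrit] at hxc
    rcases hxc with hxp | hxq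
    · have hle : (fun y => a - f y) (RegularSublevel.incl h.const_sub x) ≤ 0 :=
        RegularSublevel.apply_incl_le h.const_sub x
      rw [hxp] at hle
      exact absurd hle (by show ¬ (a - f p ≤ 0); linarith)
    · exact RegularSublevel.injective_incl h.const_sub
        (by rw [hxq, hQ, RegularSublevel.incl_mk])
  have h0 : morseIndex (𝓡∂ (k + 1))
      (fun x : RegularSuperlevel h =>
        (fun y => a - f y) (RegularSublevel.incl h.const_sub x) + (1 - 0)) Q = 0 := by
    rw [hGind Q hqcg]
    show morseIndex (𝓡 (k + 1)) (fun y => a - f y) q = 0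
    have hadd := hf.morseIndex_const_sub_add a hqc
    rw [finrank_euclideanSpace_fin, hqn] at hadd
    omega
  exact hGa.nonempty_diffeomorph_closedBall hk hQc huniq h0

end Discs

/-! ### Twisted sphere -/

section TwistedSphere

variable {k : ℕ} {M : Type} [TopologicalSpace M] [T2Space M] [CompactSpace M]
  [ChartedSpace (EuclideanSpace ℝ (Fin (k + 1))) M] [IsManifold (𝓡 (k + 1)) ∞ M] {f : M → ℝ}

/-- **A closed manifold with a Morse function having exactly two critical points is a twisted
sphere** (Milnor, *Morse theory* (1963), Thm. 4.1 with the Remark following its proof, p. 25: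
"`M` is the union of two closed `n`-cells matched along their common boundary"; Reeb 1952).
For a closed smooth manifold `M` of dimension `k + 1 ≥ 2` and a Morse function `f` on `M` whose
critical set has exactly two elements, there is a diffeomorphism `φ` of `𝕊ᵏ` with
`IsTwistedSphere k φ M`, i.e. `M = 𝔻ᵏ⁺¹ ∪_φ 𝔻ᵏ⁺¹` in the sense of `IsBoundaryGluing`: split `M`
at a level `a` between the two critical values (`RegularSublevel.isBoundaryGluing_split`), both
halves being discs (`IsMorse.nonempty_diffeomorph_closedBall_regularSublevel/Superlevel`), and
transport the gluing along the two diffeomorphisms (`IsBoundaryGluing.transfer`).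
[cite: Milnor1963, Thm. 4.1 and Remark (p. 25)] -/
theorem IsMorse.exists_isTwistedSphere_of_ncard_criticalSet_eq_two (hk : 1 ≤ k)
    (hf : IsMorse (𝓡 (k + 1)) f) (h2 : (criticalSet (𝓡 (k + 1)) f).ncard = 2) :
    ∃ φ : (Metric.sphere (0 : EuclideanSpace ℝ (Fin (k + 1))) 1) ≃ₘ⟮𝓡 k, 𝓡 k⟯
        (Metric.sphere (0 : EuclideanSpace ℝ (Fin (k + 1))) 1),
      IsTwistedSphere k φ M := by
  obtain ⟨p, q, -, hcrit, hp0, hqn, -, -, hpq⟩ :=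
    hf.exists_min_max_of_ncard_criticalSet_eq_two h2
  set a : ℝ := (f p + f q) / 2 with ha
  have hpa : f p < a := by rw [ha]; linarith
  have haq : a < f q := by rw [ha]; linarith
  have h : IsRegularLevel (𝓡 (k + 1)) f a := hf.isRegularLevel_of_criticalSet_eq_pair hcrit hpa haq
  obtain ⟨Ψ₁⟩ := hf.nonempty_diffeomorph_closedBall_regularSublevel hk hcrit hp0 hpa haq h
  obtain ⟨Ψ₂⟩ := hf.nonempty_diffeomorph_closedBall_regularSuperlevel hk hcrit hqn hpa haq h
  -- `M = Mᵃ ∪ M_a`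
  have G₀ := RegularSublevel.isBoundaryGluing_split h
  -- replace the lower half by the disc
  have G₁ := IsBoundaryGluing.transfer (b₁ := closedBallBoundaryData k) Ψ₁.symm G₀
  set φ₁ : (Metric.sphere (0 : EuclideanSpace ℝ (Fin (k + 1))) 1) ≃ₘ⟮𝓡 k, 𝓡 k⟯
      (RegularSublevel.boundaryData h.const_sub).carrier :=
    ((closedBallBoundaryData k).restrictDiffeomorph (RegularSublevel.boundaryData h) Ψ₁.symm).trans
      (RegularSublevel.splitDiffeomorph h)
  have G₁' : IsBoundaryGluing (closedBallBoundaryData k) (RegularSublevel.boundaryData h.const_sub)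
      φ₁ (𝓡 (k + 1)) M :=
    G₁
  -- swap the pieces and replace the upper half by the disc
  have G₂ := G₁'.symm'
  have G₃ := IsBoundaryGluing.transfer (b₁ := closedBallBoundaryData k) Ψ₂.symm G₂
  refine ⟨((closedBallBoundaryData k).restrictDiffeomorph
      (RegularSublevel.boundaryData h.const_sub) Ψ₂.symm).trans φ₁.symm, ?_⟩
  exact G₃

/-- **A closed smooth surface with a Morse function having exactly two critical points is
diffeomorphic to `S²`**: it is a twisted sphere `D² ∪_φ D²`
(`IsMorse.exists_isTwistedSphere_of_ncard_criticalSet_eq_two`), and every twisted `2`-sphere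
is diffeomorphic to the round sphere (`TwistedSphere.nonempty_diffeomorph_sphere_two`,
`CerfPropositionFour.lean`: every diffeomorphism of `S¹` extends over `D²`).  Milnor 1963,
Thm. 4.1 and Remark; Kervaire–Milnor 1963, p. 507 (`Θ₂ = 0`).
[cite: Milnor1963, Thm. 4.1 and Remark (p. 25)] [cite: KervaireMilnorAnnals1963, §2 p. 507] -/
theorem IsMorse.nonempty_diffeomorph_sphere_two_of_ncard_criticalSet_eq_two {M : Type}
    [TopologicalSpace M] [T2Space M] [SecondCountableTopology M] [CompactSpace M]
    [ChartedSpace (EuclideanSpace ℝ (Fin 2)) M] [IsManifold (𝓡 2) ∞ M] {f : M → ℝ}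
    (hf : IsMorse (𝓡 2) f) (h2 : (criticalSet (𝓡 2) f).ncard = 2) :
    Nonempty (M ≃ₘ⟮𝓡 2, 𝓡 2⟯ (Metric.sphere (0 : EuclideanSpace ℝ (Fin 3)) 1)) := by
  obtain ⟨φ, hφ⟩ := hf.exists_isTwistedSphere_of_ncard_criticalSet_eq_two (k := 1) le_rfl h2
  exact TwistedSphere.nonempty_diffeomorph_sphere_two { carrier := M, isTwistedSphere := hφ }

/-- **Reeb's sphere theorem in dimension `2`, discharged**: the dimension-`2` instance (for
surfaces in `Type`) of the tree's named fact
`Literature.Topology.FourManifolds.nonempty_homeomorph_sphere_of_ncard_criticalSet_eq_two`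
(`Morse.lean`; Reeb 1952, Milnor 1963 Thm. 4.1) — even with a diffeomorphism.
[cite: Milnor1963, Thm. 4.1] -/
theorem nonempty_homeomorph_sphere_of_ncard_criticalSet_eq_two_two (M : Type)
    [TopologicalSpace M] [T2Space M] [SecondCountableTopology M] [CompactSpace M]
    [ChartedSpace (EuclideanSpace ℝ (Fin 2)) M] [IsManifold (𝓡 2) ∞ M] :
    nonempty_homeomorph_sphere_of_ncard_criticalSet_eq_two 2 M := by
  intro f hf h2
  obtain ⟨Φ⟩ := hf.nonempty_diffeomorph_sphere_two_of_ncard_criticalSet_eq_two h2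
  exact ⟨Φ.toHomeomorph⟩

end TwistedSphere

end Literature.Topology.FourManifolds

end
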